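import Mathlib.Tactic.Linarith
import Mathlib.Data.Real.Basic
import Summits.CriticalPhenomena.PercolationContinuityZ3.Theorems.PercNearOneGluingNoHeavyLowerTailSahiCTCFormsEdgeMove
import HarnessLib

/-!
# `NoHeavyLowerTail` (crux stmt-CriticalPhenomena-4575), P3 lane: THE REDUCTION THEOREM (memo g17 §1.3, Corollary) in Lean —
# every all-live pair of complexes dominates, coefficientwise, a FLAG pair with NO common non-edge

Support file (seat `prim-l12-p3`, gen 18; `--supports stmt-CriticalPhenomena-4575`).  Companions: `…SahiCTCForms` (dictionary, closed forms,
face move (M2)), `…SahiCTCFormsEdgeMove` (edge move (M1)).  Memo `run/shared/lean/prim/prim-l12/FROM-prim-l12-p3-g17-REDUCTION-TO-3-COLOURINGS.md` §1.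

* `coeff_forms_antitone_left` : if `K_Z` is a down-set and `K_X ⊆ K_X⁺` where every added set has size `≥ 3` or is a 2-set not in `K_Z`, then
  `G(K_X⁺, K_Z) ≤ G(K_X, K_Z)` coefficientwise for `G ∈ {G022, G122, G222}` (iterate (M1)/(M2)); `…_right` symmetrically (the forms are symmetric,
  `Q_comm` etc.).
* `cliqueCx E` : the clique (flag) complex of a set `E` of 2-sets — all sets all of whose 2-subsets lie in `E`; a down-set containing every set of
  size ≤ 1, whose 2-sets are exactly the 2-sets of `E`.
* `coeff_forms_reduction` : **THE REDUCTION.**  For down-sets `K_X, K_Z` containing all sets of size `≤ 1` (an all-live pair) and any split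
  `A ⊆ ω` of the common non-edges (`A` to `X`, `ω ∖ A` to `Z`), the flag pair `K_X' = Cl(E_X ∪ A)`, `K_Z' = Cl(E_Z ∪ (ω ∖ A))` satisfies
  `G(K_X', K_Z') ≤ G(K_X, K_Z)` coefficientwise for the three forms, and `ω(K_X', K_Z') = ∅` (`omega_reduction_eq_empty`).
* `N2gen` : the generic c = 2 certificate polynomial `Ñ₂(K_X,K_Z)` in g9's form (A), and `N2gen_eq_G222` : `Ñ₂ = G222` whenever both complexes
  contain every set of size `≤ 1` (memo g10 §1) — so the reduction applies to the actual `(TC)`-row polynomial of all-live pairs.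
So any coefficientwise lower bound (e.g. `≥ 0`) proved for flag pairs without common non-edges — i.e. for 3-colourings `Y/x/z` of `E(K_n)` — holds for
all all-live pairs (memo g17 §2).  Nothing is asserted about the crux; no positivity of the forms is claimed.
-/

namespace Summit.CriticalPhenomena.PercolationContinuityZ3.Theorems.SahiCTCForms

open Finset MvPolynomial SahiCTCGenFun

variable {α : Type*} [DecidableEq α] [Fintype α]

/-! ### Iterating the moves: antitonicity in each complex -/

/-- Iterated (M1)/(M2): enlarging `K_X` by sets of size `≥ 3` and by 2-sets that are not in `K_Z` can only LOWER the three forms coefficientwise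
(`K_Z` a down-set). [this work] -/
theorem coeff_forms_antitone_left {KZ : Finset (Finset α)} (hKZ : IsLowerSet (KZ : Set (Finset α))) :
    ∀ (k : ℕ) (KX₀ KX : Finset (Finset α)), #(KX \ KX₀) = k → KX₀ ⊆ KX →
      (∀ S ∈ KX, S ∉ KX₀ → 3 ≤ #S ∨ (#S = 2 ∧ S ∉ KZ)) → ∀ n : α →₀ ℕ,
      (G022 KX KZ).coeff n ≤ (G022 KX₀ KZ).coeff n ∧ (G122 KX KZ).coeff n ≤ (G122 KX₀ KZ).coeff n ∧
        (G222 KX KZ).coeff n ≤ (G222 KX₀ KZ).coeff n := by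
  intro k
  induction k with
  | zero =>
    intro KX₀ KX hk hsub _ n
    have : KX = KX₀ := by
      have h := Finset.sdiff_eq_empty_iff_subset.1 (card_eq_zero.1 hk)
      exact Subset.antisymm h hsub
    subst this
    exact ⟨le_rfl, le_rfl, le_rfl⟩
  | succ k ih =>
    intro KX₀ KX hk hsub hdiff n
    obtain ⟨S, hS⟩ : (KX \ KX₀).Nonempty := card_pos.1 (by omega)
    obtain ⟨hSK, hS0⟩ := mem_sdiff.1 hS
    -- one move at `S`
    have hstep : (G022 KX KZ).coeff n ≤ (G022 (KX.erase S) KZ).coeff n ∧ (G122 KX KZ).coeff n ≤ (G122 (KX.erase S) KZ).coeff n ∧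
        (G222 KX KZ).coeff n ≤ (G222 (KX.erase S) KZ).coeff n := by
      rcases hdiff S hSK hS0 with h3 | ⟨h2, hZ⟩
      · exact coeff_forms_le_erase_face hKZ hSK h3 n
      · exact coeff_forms_le_erase_edge hSK hZ h2 n
    -- induction hypothesis for `KX.erase S`
    have hk' : #(KX.erase S \ KX₀) = k := by
      have : KX.erase S \ KX₀ = (KX \ KX₀).erase S := by
        ext T; simp only [mem_sdiff, mem_erase]; tauto
      rw [this, card_erase_of_mem hS, hk]; rfl
    have hsub' : KX₀ ⊆ KX.erase S := fun T hT => mem_erase.2 ⟨fun h => hS0 (h ▸ hT), hsub hT⟩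
    have hdiff' : ∀ T ∈ KX.erase S, T ∉ KX₀ → 3 ≤ #T ∨ (#T = 2 ∧ T ∉ KZ) := fun T hT hT0 => hdiff T (mem_of_mem_erase hT) hT0
    obtain ⟨i0, i1, i2⟩ := ih KX₀ (KX.erase S) hk' hsub' hdiff' n
    exact ⟨hstep.1.trans i0, hstep.2.1.trans i1, hstep.2.2.trans i2⟩

/-- `ω` is symmetric. [this work] -/
theorem omega_comm (KX KZ : Finset (Finset α)) : omega KX KZ = omega KZ KX := by
  ext S; simp only [omega, mem_filter]; tauto

/-- `η` is symmetric. [this work] -/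
theorem eta_comm (KX KZ : Finset (Finset α)) : eta KX KZ = eta KZ KX := by
  ext S; simp only [eta, mem_filter]; tauto

/-- `E_Y` is symmetric. [this work] -/
theorem commonEdges_comm (KX KZ : Finset (Finset α)) : commonEdges KX KZ = commonEdges KZ KX := by
  ext S; simp only [commonEdges, mem_filter]; tauto

/-- The forms are symmetric under `X ↔ Z`. [this work] -/
theorem forms_comm (KX KZ : Finset (Finset α)) :
    G022 KX KZ = G022 KZ KX ∧ G122 KX KZ = G122 KZ KX ∧ G222 KX KZ = G222 KZ KX := by
  have hQ : Q KX KZ = Q KZ KX := by unfold Q; rw [omega_comm]; ring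
  refine ⟨?_, ?_, ?_⟩
  · unfold G022; rw [hQ]
  · unfold G122; rw [hQ, eta_comm]
  · unfold G222; rw [hQ, eta_comm]

/-- Antitonicity in the second complex (by symmetry). [this work] -/
theorem coeff_forms_antitone_right {KX KZ₀ KZ : Finset (Finset α)} (hKX : IsLowerSet (KX : Set (Finset α))) (hsub : KZ₀ ⊆ KZ)
    (hdiff : ∀ S ∈ KZ, S ∉ KZ₀ → 3 ≤ #S ∨ (#S = 2 ∧ S ∉ KX)) (n : α →₀ ℕ) :
    (G022 KX KZ).coeff n ≤ (G022 KX KZ₀).coeff n ∧ (G122 KX KZ).coeff n ≤ (G122 KX KZ₀).coeff n ∧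
      (G222 KX KZ).coeff n ≤ (G222 KX KZ₀).coeff n := by
  obtain ⟨a, b, c⟩ := forms_comm KX KZ
  obtain ⟨a0, b0, c0⟩ := forms_comm KX KZ₀
  rw [a, b, c, a0, b0, c0]
  exact coeff_forms_antitone_left hKX _ KZ₀ KZ rfl hsub hdiff n

/-! ### Clique (flag) complexes -/

/-- The clique complex of a family `E` of 2-sets: all sets all of whose 2-subsets belong to `E`. [this work] -/
def cliqueCx (E : Finset (Finset α)) : Finset (Finset α) := univ.powerset.filter fun S => ∀ e, e ⊆ S → #e = 2 → e ∈ E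

omit [DecidableEq α] in
/-- Membership in the clique complex. [this work] -/
theorem mem_cliqueCx [DecidableEq α] {E : Finset (Finset α)} {S : Finset α} : S ∈ cliqueCx E ↔ ∀ e, e ⊆ S → #e = 2 → e ∈ E := by
  simp [cliqueCx]

/-- The clique complex is a down-set. [this work] -/
theorem isLowerSet_cliqueCx (E : Finset (Finset α)) : IsLowerSet ((cliqueCx E : Finset (Finset α)) : Set (Finset α)) := by
  intro S T hTS hS
  rw [Finset.mem_coe, mem_cliqueCx] at hS ⊢
  exact fun e he h2 => hS e (he.trans hTS) h2

/-- Sets of size `≤ 1` lie in every clique complex. [this work] -/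
theorem mem_cliqueCx_of_card_le_one (E : Finset (Finset α)) {S : Finset α} (hS : #S ≤ 1) : S ∈ cliqueCx E := by
  rw [mem_cliqueCx]
  intro e he h2
  have := card_le_card he
  omega

/-- A 2-set lies in the clique complex iff it lies in `E`. [this work] -/
theorem two_mem_cliqueCx_iff (E : Finset (Finset α)) {S : Finset α} (hS : #S = 2) : S ∈ cliqueCx E ↔ S ∈ E := by
  rw [mem_cliqueCx]
  constructor
  · intro h; exact h S Subset.rfl hS
  · intro h e he h2
    have : e = S := eq_of_subset_of_card_le he (by rw [hS, h2])
    rw [this]; exact h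

/-- A down-set is contained in the clique complex of any edge set containing its 2-faces. [this work] -/
theorem subset_cliqueCx_of_isLowerSet {K E : Finset (Finset α)} (hK : IsLowerSet (K : Set (Finset α))) (hE : edgesOf K ⊆ E) :
    K ⊆ cliqueCx E := by
  intro S hS
  rw [mem_cliqueCx]
  intro e he h2
  exact hE (mem_filter.2 ⟨mem_powerset.2 (subset_univ _), h2, hK he hS⟩)

/-! ### The reduction to flag pairs with no common non-edge -/

/-- The X-side of the reduced pair: the clique complex of `E_X ∪ A`. [this work] -/
def redX (KX A : Finset (Finset α)) : Finset (Finset α) := cliqueCx (edgesOf KX ∪ A)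

/-- The Z-side of the reduced pair: the clique complex of `E_Z ∪ (ω ∖ A)`. [this work] -/
def redZ (KX KZ A : Finset (Finset α)) : Finset (Finset α) := cliqueCx (edgesOf KZ ∪ (omega KX KZ \ A))

/-- **THE REDUCTION THEOREM (memo g17 §1.3, Corollary).**  Let `K_X, K_Z` be down-sets containing every set of size `≤ 1` (an all-live pair) and
`A ⊆ ω` a set of common non-edges handed to `X` (the rest `ω ∖ A` go to `Z`).  Then the flag pair `(Cl(E_X ∪ A), Cl(E_Z ∪ (ω ∖ A)))` has
coefficientwise SMALLER `G022`, `G122`, `G222`.  (With `omega_reduction_eq_empty`: to prove a coefficientwise lower bound for all all-live pairs it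
suffices to prove it for flag pairs with no common non-edge, i.e. for 3-colourings of `E(K_n)`.) [this work] -/
theorem coeff_forms_reduction {KX KZ A : Finset (Finset α)} (hKX : IsLowerSet (KX : Set (Finset α))) (hKZ : IsLowerSet (KZ : Set (Finset α)))
    (hX1 : ∀ S : Finset α, #S ≤ 1 → S ∈ KX) (hZ1 : ∀ S : Finset α, #S ≤ 1 → S ∈ KZ) (hA : A ⊆ omega KX KZ) (n : α →₀ ℕ) :
    (G022 (redX KX A) (redZ KX KZ A)).coeff n ≤ (G022 KX KZ).coeff n ∧
    (G122 (redX KX A) (redZ KX KZ A)).coeff n ≤ (G122 KX KZ).coeff n ∧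
    (G222 (redX KX A) (redZ KX KZ A)).coeff n ≤ (G222 KX KZ).coeff n := by
  -- step 1: enlarge K_X to the flag complex K_X'
  have hsubX : KX ⊆ redX KX A := subset_cliqueCx_of_isLowerSet hKX subset_union_left
  have hdiffX : ∀ S ∈ redX KX A, S ∉ KX → 3 ≤ #S ∨ (#S = 2 ∧ S ∉ KZ) := by
    intro S hS hSX
    by_cases h1 : #S ≤ 1
    · exact absurd (hX1 S h1) hSX
    by_cases h2 : #S = 2
    · right; refine ⟨h2, ?_⟩
      have hmem := (two_mem_cliqueCx_iff _ h2).1 hS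
      rcases mem_union.1 hmem with h | h
      · exact absurd (mem_filter.1 h).2.2 hSX
      · exact (mem_filter.1 (hA h)).2.2.2
    · left; omega
  have step1 := coeff_forms_antitone_left hKZ _ KX (redX KX A) rfl hsubX hdiffX n
  -- step 2: enlarge K_Z to the flag complex K_Z', against the down-set K_X'
  have hsubZ : KZ ⊆ redZ KX KZ A := subset_cliqueCx_of_isLowerSet hKZ subset_union_left
  have hdiffZ : ∀ S ∈ redZ KX KZ A, S ∉ KZ → 3 ≤ #S ∨ (#S = 2 ∧ S ∉ redX KX A) := by
    intro S hS hSZ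
    by_cases h1 : #S ≤ 1
    · exact absurd (hZ1 S h1) hSZ
    by_cases h2 : #S = 2
    · right; refine ⟨h2, ?_⟩
      have hmem := (two_mem_cliqueCx_iff _ h2).1 hS
      rcases mem_union.1 hmem with h | h
      · exact absurd (mem_filter.1 h).2.2 hSZ
      · obtain ⟨hω, hnA⟩ := mem_sdiff.1 h
        intro hSX'
        have hmemX := (two_mem_cliqueCx_iff _ h2).1 hSX'
        rcases mem_union.1 hmemX with h' | h'
        · exact (mem_filter.1 hω).2.2.1 (mem_filter.1 h').2.2
        · exact hnA h'
    · left; omega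
  have step2 := coeff_forms_antitone_right (KX := redX KX A) (isLowerSet_cliqueCx _) hsubZ hdiffZ n
  exact ⟨step2.1.trans step1.1, step2.2.1.trans step1.2.1, step2.2.2.trans step1.2.2⟩

/-- The reduced pair has NO common non-edge (for any `A`). [this work] -/
theorem omega_reduction_eq_empty (KX KZ A : Finset (Finset α)) : omega (redX KX A) (redZ KX KZ A) = ∅ := by
  refine filter_eq_empty_iff.2 fun S _ h => ?_
  obtain ⟨h2, hX, hZ⟩ := h
  rw [redX, two_mem_cliqueCx_iff _ h2] at hX
  rw [redZ, two_mem_cliqueCx_iff _ h2] at hZ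
  -- `S` is neither an X-edge, nor in `A`, nor a Z-edge, nor in `ω \ A`: impossible
  by_cases hSX : S ∈ KX
  · exact hX (mem_union_left _ (mem_filter.2 ⟨mem_powerset.2 (subset_univ _), h2, hSX⟩))
  by_cases hSZ : S ∈ KZ
  · exact hZ (mem_union_left _ (mem_filter.2 ⟨mem_powerset.2 (subset_univ _), h2, hSZ⟩))
  have hω : S ∈ omega KX KZ := mem_filter.2 ⟨mem_powerset.2 (subset_univ _), h2, hSX, hSZ⟩
  by_cases hSA : S ∈ A
  · exact hX (mem_union_right _ hSA)
  · exact hZ (mem_union_right _ (mem_sdiff.2 ⟨hω, hSA⟩))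

/-- The reduced complexes are flag: each is the clique complex of its own edge set. [this work] -/
theorem red_flag {KX KZ A : Finset (Finset α)} (hA : A ⊆ omega KX KZ) :
    redX KX A = cliqueCx (edgesOf (redX KX A)) ∧ redZ KX KZ A = cliqueCx (edgesOf (redZ KX KZ A)) := by
  have key : ∀ E : Finset (Finset α), (∀ e ∈ E, #e = 2) → cliqueCx E = cliqueCx (edgesOf (cliqueCx E)) := by
    intro E hE
    have hedges : edgesOf (cliqueCx E) = E := by
      ext S; rw [edgesOf, mem_filter]
      constructor
      · rintro ⟨_, h2, h⟩; exact (two_mem_cliqueCx_iff _ h2).1 h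
      · intro h; exact ⟨mem_powerset.2 (subset_univ _), hE S h, (two_mem_cliqueCx_iff _ (hE S h)).2 h⟩
    rw [hedges]
  have hEX : ∀ e ∈ edgesOf KX ∪ A, #e = 2 := fun e he => by
    rcases mem_union.1 he with h | h
    · exact (mem_filter.1 h).2.1
    · exact (mem_filter.1 (hA h)).2.1
  have hEZ : ∀ e ∈ edgesOf KZ ∪ (omega KX KZ \ A), #e = 2 := fun e he => by
    rcases mem_union.1 he with h | h
    · exact (mem_filter.1 h).2.1
    · exact (mem_filter.1 (mem_sdiff.1 h).1).2.1
  exact ⟨key _ hEX, key _ hEZ⟩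

/-! ### The generic `(TC)`-row polynomial `Ñ₂` (g9 form (A)) equals the closed form `G222` on all-live pairs (memo g10 §1) -/

/-- Faces of size `≤ 2` of a complex (`h_K`). [this work] -/
def smallFaces (K : Finset (Finset α)) : Finset (Finset α) := univ.powerset.filter fun S => #S ≤ 2 ∧ S ∈ K

/-- Faces of size `≥ 3` of a complex (`t_K`). [this work] -/
def bigFaces (K : Finset (Finset α)) : Finset (Finset α) := univ.powerset.filter fun S => 3 ≤ #S ∧ S ∈ K

/-- Common faces of size `≤ 2` (`h_Y`). [this work] -/
def smallCommonFaces (KX KZ : Finset (Finset α)) : Finset (Finset α) := univ.powerset.filter fun S => #S ≤ 2 ∧ S ∈ KX ∧ S ∈ KZ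

/-- **The generic c = 2 certificate polynomial `Ñ₂(K_X, K_Z)`** in g9's form (A) (memo g9 §1: `Ñ_c = e_c(Π+D)(Π·h_Y − h_X·h_Z) − Θ·Π·D·e_Y −
e_c·D·(h_X·t_Z + t_X·h_Z) + e_c·Θ·t_X·t_Z`, `c = 2`, with `h = GF(faces of size ≤ 2)`, `t = GF(faces of size ≥ 3)`, `h_Y` = common small faces,
`e_Y` = common edges).  By g9 §1, `Ñ₂(K_X,K_Z)(r) ≥ 0` at the odds vector `r` is exactly the (TC) row of the c = 2 threshold certificate at the
pair of up-sets with closed-set complexes `K_X, K_Z` (that probabilistic identification is not formalised here). [this work] -/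
noncomputable def N2gen (KX KZ : Finset (Finset α)) : MvPolynomial α ℤ :=
  ee 2 * (PiP + Dd) * (PiP * gf (smallCommonFaces KX KZ) - gf (smallFaces KX) * gf (smallFaces KZ))
    - Th * PiP * Dd * gf (commonEdges KX KZ)
    - ee 2 * Dd * (gf (smallFaces KX) * gf (bigFaces KZ) + gf (bigFaces KX) * gf (smallFaces KZ))
    + ee 2 * Th * gf (bigFaces KX) * gf (bigFaces KZ)

/-- `h_K = Θ₁ + E_K` when `K` contains all sets of size `≤ 1`. [this work] -/
theorem gf_smallFaces_eq {K : Finset (Finset α)} (hK1 : ∀ S : Finset α, #S ≤ 1 → S ∈ K) :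
    gf (smallFaces K) = (Th1 : MvPolynomial α ℤ) + gf (edgesOf K) := by
  have hU : smallFaces K = (bySize (· ≤ 1) : Finset (Finset α)) ∪ edgesOf K := by
    ext S; simp only [smallFaces, bySize, edgesOf, mem_filter, mem_union, mem_powerset]
    constructor
    · rintro ⟨hS, h2, hK⟩
      rcases Nat.lt_or_ge #S 2 with h | h
      · exact Or.inl ⟨hS, by omega⟩
      · exact Or.inr ⟨hS, by omega, hK⟩
    · rintro (⟨hS, h⟩ | ⟨hS, h, hK⟩)
      · exact ⟨hS, by omega, hK1 S h⟩
      · exact ⟨hS, by omega, hK⟩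
  have hD : Disjoint (bySize (· ≤ 1) : Finset (Finset α)) (edgesOf K) := by
    rw [disjoint_left]; intro S h1 h2; simp only [bySize, edgesOf, mem_filter] at h1 h2; omega
  unfold Th1; rw [hU, gf_union hD]

/-- `h_Y = Θ₁ + E_Y` when both complexes contain all sets of size `≤ 1`. [this work] -/
theorem gf_smallCommonFaces_eq {KX KZ : Finset (Finset α)} (hX1 : ∀ S : Finset α, #S ≤ 1 → S ∈ KX) (hZ1 : ∀ S : Finset α, #S ≤ 1 → S ∈ KZ) :
    gf (smallCommonFaces KX KZ) = (Th1 : MvPolynomial α ℤ) + gf (commonEdges KX KZ) := by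
  have hU : smallCommonFaces KX KZ = (bySize (· ≤ 1) : Finset (Finset α)) ∪ commonEdges KX KZ := by
    ext S; simp only [smallCommonFaces, bySize, commonEdges, mem_filter, mem_union, mem_powerset]
    constructor
    · rintro ⟨hS, h2, hX, hZ⟩
      rcases Nat.lt_or_ge #S 2 with h | h
      · exact Or.inl ⟨hS, by omega⟩
      · exact Or.inr ⟨hS, by omega, hX, hZ⟩
    · rintro (⟨hS, h⟩ | ⟨hS, h, hX, hZ⟩)
      · exact ⟨hS, by omega, hX1 S h, hZ1 S h⟩
      · exact ⟨hS, by omega, hX, hZ⟩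
  have hD : Disjoint (bySize (· ≤ 1) : Finset (Finset α)) (commonEdges KX KZ) := by
    rw [disjoint_left]; intro S h1 h2; simp only [bySize, commonEdges, mem_filter] at h1 h2; omega
  unfold Th1; rw [hU, gf_union hD]

/-- `D = t_K + t̄_K`. [this work] -/
theorem Dd_eq_bigFaces (K : Finset (Finset α)) : (Dd : MvPolynomial α ℤ) = gf (bigFaces K) + gf (bigNonFaces K) := by
  have hU : (bySize (3 ≤ ·) : Finset (Finset α)) = bigFaces K ∪ bigNonFaces K := by
    ext S; simp only [bySize, bigFaces, bigNonFaces, mem_filter, mem_union]; tauto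
  have hD : Disjoint (bigFaces K) (bigNonFaces K) := by
    rw [disjoint_left]; intro S h1 h2; simp only [bigFaces, bigNonFaces, mem_filter] at h1 h2; tauto
  unfold Dd; rw [hU, gf_union hD]

/-- `Θ = Θ₁ + e₂`. [this work] -/
theorem Th_eq : (Th : MvPolynomial α ℤ) = Th1 + ee 2 := by
  have hU : (bySize (· ≤ 2) : Finset (Finset α)) = bySize (· ≤ 1) ∪ bySize (· = 2) := by
    ext S; simp only [bySize, mem_filter, mem_union]
    constructor
    · rintro ⟨hS, h⟩; rcases Nat.lt_or_ge #S 2 with h' | h'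
      · exact Or.inl ⟨hS, by omega⟩
      · exact Or.inr ⟨hS, by omega⟩
    · rintro (⟨hS, h⟩ | ⟨hS, h⟩) <;> exact ⟨hS, by omega⟩
  have hD : Disjoint (bySize (· ≤ 1) : Finset (Finset α)) (bySize (· = 2)) := by
    rw [disjoint_left]; intro S h1 h2; simp only [bySize, mem_filter] at h1 h2; omega
  unfold Th Th1 ee; rw [hU, gf_union hD]

/-- `E_X = E_Y + ξ_Z` and `ε̄_X = ω + ξ_X`, where `ξ_X` = 2-sets that are non-edges of `X` but edges of `Z` (X-only non-edges). [this work] -/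
theorem edges_nonEdges_split (KX KZ : Finset (Finset α)) :
    gf (edgesOf KX) = gf (commonEdges KX KZ) + gf (univ.powerset.filter fun S => #S = 2 ∧ S ∉ KZ ∧ S ∈ KX) ∧
    gf (nonEdges KX) = gf (omega KX KZ) + gf (univ.powerset.filter fun S => #S = 2 ∧ S ∉ KX ∧ S ∈ KZ) := by
  constructor
  · have hU : edgesOf KX = commonEdges KX KZ ∪ (univ.powerset.filter fun S => #S = 2 ∧ S ∉ KZ ∧ S ∈ KX) := by
      ext S; simp only [edgesOf, commonEdges, mem_filter, mem_union]; tauto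
    have hD : Disjoint (commonEdges KX KZ) (univ.powerset.filter fun S => #S = 2 ∧ S ∉ KZ ∧ S ∈ KX) := by
      rw [disjoint_left]; intro S h1 h2; simp only [commonEdges, mem_filter] at h1 h2; tauto
    rw [hU, gf_union hD]
  · have hU : nonEdges KX = omega KX KZ ∪ (univ.powerset.filter fun S => #S = 2 ∧ S ∉ KX ∧ S ∈ KZ) := by
      ext S; simp only [nonEdges, omega, mem_filter, mem_union]; tauto
    have hD : Disjoint (omega KX KZ) (univ.powerset.filter fun S => #S = 2 ∧ S ∉ KX ∧ S ∈ KZ) := by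
      rw [disjoint_left]; intro S h1 h2; simp only [omega, mem_filter] at h1 h2; tauto
    rw [hU, gf_union hD]

/-- `e₂ = E_Y + ξ_X + ξ_Z + ω` via `η = ξ_X + ξ_Z + ω`. [this work] -/
theorem gf_eta_split (KX KZ : Finset (Finset α)) :
    gf (eta KX KZ) = gf (omega KX KZ) + gf (univ.powerset.filter fun S => #S = 2 ∧ S ∉ KX ∧ S ∈ KZ) +
      gf (univ.powerset.filter fun S => #S = 2 ∧ S ∉ KZ ∧ S ∈ KX) := by
  have hU : eta KX KZ = (omega KX KZ ∪ (univ.powerset.filter fun S => #S = 2 ∧ S ∉ KX ∧ S ∈ KZ)) ∪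
      (univ.powerset.filter fun S => #S = 2 ∧ S ∉ KZ ∧ S ∈ KX) := by
    ext S; simp only [eta, omega, mem_filter, mem_union]; tauto
  have hD1 : Disjoint (omega KX KZ) (univ.powerset.filter fun S => #S = 2 ∧ S ∉ KX ∧ S ∈ KZ) := by
    rw [disjoint_left]; intro S h1 h2; simp only [omega, mem_filter] at h1 h2; tauto
  have hD2 : Disjoint (omega KX KZ ∪ (univ.powerset.filter fun S => #S = 2 ∧ S ∉ KX ∧ S ∈ KZ))
      (univ.powerset.filter fun S => #S = 2 ∧ S ∉ KZ ∧ S ∈ KX) := by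
    rw [disjoint_left]; intro S h1 h2; simp only [omega, mem_filter, mem_union] at h1 h2; tauto
  rw [hU, gf_union hD2, gf_union hD1]

/-- **`Ñ₂ = G222` on all-live pairs** (memo g10 §1: the closed form of the c = 2 certificate polynomial when both complexes contain every set of
size `≤ 1`).  Hence everything proved for `G222` (the reduction theorem above; the identities of `…SahiCTCForms`) is a statement about the actual
`(TC)`-row polynomial. [this work] -/
theorem N2gen_eq_G222 {KX KZ : Finset (Finset α)} (hX1 : ∀ S : Finset α, #S ≤ 1 → S ∈ KX) (hZ1 : ∀ S : Finset α, #S ≤ 1 → S ∈ KZ) :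
    N2gen KX KZ = G222 KX KZ := by
  have hX := gf_smallFaces_eq hX1
  have hZ := gf_smallFaces_eq hZ1
  have hY := gf_smallCommonFaces_eq hX1 hZ1
  have hDX := Dd_eq_bigFaces (α := α) KX
  have hDZ := Dd_eq_bigFaces (α := α) KZ
  have hTh := Th_eq (α := α)
  have hPi := PiP_eq_sizes (α := α)
  obtain ⟨hEX, hNX⟩ := edges_nonEdges_split KX KZ
  obtain ⟨hEZ, hNZ⟩ := edges_nonEdges_split KZ KX
  rw [commonEdges_comm KZ KX, omega_comm KZ KX] at *
  have hη := gf_eta_split KX KZ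
  have he2 := gf_pairs_eq (α := α) KX KZ
  -- express the face generating functions through the free atoms and close by `ring`
  have htX : gf (bigFaces KX) = (Dd : MvPolynomial α ℤ) - gf (bigNonFaces KX) := by rw [hDX]; ring
  have htZ : gf (bigFaces KZ) = (Dd : MvPolynomial α ℤ) - gf (bigNonFaces KZ) := by rw [hDZ]; ring
  unfold N2gen G222 Q
  unfold ee at he2 hTh hPi ⊢
  rw [hY, hX, hZ, htX, htZ, hEX, hEZ, hNX, hNZ, hTh, hPi, he2, hη]
  ring

/-! ### Value-level reading: evaluating at a nonnegative real vector preserves coefficientwise inequalities -/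

omit [DecidableEq α] [Fintype α] in
/-- Coefficientwise `P ≤ Q` implies `P(r) ≤ Q(r)` at every `r ≥ 0` (evaluation in `ℝ`).  With `coeff_forms_reduction`: the real number
`Ñ₂(K_X,K_Z)(r)` (the (TC)-row slack at odds `r`) is at least its value on the reduced flag pair. [folklore] -/
theorem eval_le_of_coeff_le {P Q : MvPolynomial α ℤ} (h : ∀ m, P.coeff m ≤ Q.coeff m) (r : α → ℝ) (hr : ∀ i, 0 ≤ r i) :
    MvPolynomial.eval₂ (Int.castRingHom ℝ) r P ≤ MvPolynomial.eval₂ (Int.castRingHom ℝ) r Q := by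
  have key : ∀ R : MvPolynomial α ℤ, (∀ m, 0 ≤ R.coeff m) → 0 ≤ MvPolynomial.eval₂ (Int.castRingHom ℝ) r R := by
    intro R hR
    rw [MvPolynomial.eval₂_eq]
    refine Finset.sum_nonneg fun m _ => mul_nonneg ?_ (Finset.prod_nonneg fun i _ => pow_nonneg (hr i) _)
    rw [eq_intCast]; exact_mod_cast hR m
  have := key (Q - P) (fun m => by rw [coeff_sub]; linarith [h m])
  rw [MvPolynomial.eval₂_sub] at this
  linarith

/-- **Value-level reduction**: for an all-live pair and `r ≥ 0`, `Ñ₂(K_X,K_Z)(r) ≥ Ñ₂-closed-form of the reduced flag pair at `r`; in particular if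
`G222 ≥ 0` at `r` for every flag pair with no common non-edge then the (TC)-row polynomial is `≥ 0` at `r` for every all-live pair. [this work] -/
theorem eval_N2gen_ge_reduction {KX KZ A : Finset (Finset α)} (hKX : IsLowerSet (KX : Set (Finset α))) (hKZ : IsLowerSet (KZ : Set (Finset α)))
    (hX1 : ∀ S : Finset α, #S ≤ 1 → S ∈ KX) (hZ1 : ∀ S : Finset α, #S ≤ 1 → S ∈ KZ) (hA : A ⊆ omega KX KZ) (r : α → ℝ) (hr : ∀ i, 0 ≤ r i) :
    MvPolynomial.eval₂ (Int.castRingHom ℝ) r (G222 (redX KX A) (redZ KX KZ A)) ≤ MvPolynomial.eval₂ (Int.castRingHom ℝ) r (N2gen KX KZ) := by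
  rw [N2gen_eq_G222 hX1 hZ1]
  exact eval_le_of_coeff_le (fun m => (coeff_forms_reduction hKX hKZ hX1 hZ1 hA m).2.2) r hr

end Summit.CriticalPhenomena.PercolationContinuityZ3.Theorems.SahiCTCForms
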